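import Summits.Ventures.PercRepro.PassScheme
import Summits.Ventures.PercRepro.C026Class

/-!
# C-026: the pass scheme of mine-3 in Lean — injective by construction, C-026 modulo completeness (p5, gen 7)

mine-3's canonical scheme for the residual `Bot₃ ↪ ac|b ⊔ bc|a` (`proofs/MINE3-Q3-gzpass.md` §2,
`data/mine-3/gz/q3-pass-final.out`: `0` uncovered on all graphs with `n ≤ 6` and on `n = 7, m ≤ 13`):
the reduced scheme runs the passes

* P2 `τ₅₀(S) = S Δ (E[M] ∖ E[L])` (the `M`-swap with `L` sealed) → `ac|b`,
* P3 `τ₄(S) = S Δ (E[L] ∖ E[K])` (the `L`-swap with `K` sealed) → `bc|a`,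
* P4 `τ₄₀(S) = S Δ (E[K] ∖ E[L])` (the `K`-swap with `L` sealed) → `ac|b`,
* P5 `τ₁₈(S) = S Δ (E[M] ∖ E[K])` (the `M`-swap with `K` sealed) → `bc|a`,
* P7 `S ∪ {e}` for the `K–M` edges `e` in edge order → `ac|b` (`cellAC_update_of_isBot_of_isKM`: for
  `S ∈ bot` every such target IS in `ac|b`),
* P8 `S ∪ X` for `|X| ≤ 2` in edge order → `ac|b ⊔ bc|a`,

on the residual `Bot₃` in any fixed order (P1, the identity into `ab|c`, is the `ab|c` part of `Bad₃`
removed by `card_bad3_le_iff`; P6, the cut tree into `ab|c`, can never serve: every `ab|c`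
configuration is bad and takes itself in P1).  The four tree passes are typer-1's `kSwapSealed`
(`kSwapSealed_injective` — the cube bijections of the sheet); the scheme is `PassScheme.run`.

* the generic layer: `pairsOf`, `oneEdgePassOrd` / `twoEdgePassOrd` (edge-adding passes with a caller-supplied
  candidate order), **`SchemeComplete R passes`** and **`card_le_of_schemeComplete`** — ANY scheme whose candidates
  lie in `ac|b ⊔ bc|a` bounds its source set once it is complete (the t66 mirror of mine-3's C6′ is `C026PassM.lean`);
* **`q3Passes`**, **`Q3Complete`** — «after the passes no residual configuration is left» (mine-3's
  claim C6, the only open piece: `8` configurations on two `6`-vertex graphs use P8 at `n ≤ 6`);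
* **`card_bot3_le_of_q3Complete`** — the injection is by construction (`PassScheme.inv_run`), so a
  complete scheme gives the class lemma `#Bot₃ ≤ #(ac|b) + #(bc|a)`;
* **`C026UpTo_of_q3Complete`** — C-026 on every multigraph with ≤ N vertices, at every `p`, from the
  completeness of the scheme on the simple graphs with ≤ N vertices and three distinct marks.
-/

namespace PercRepro

open Finset

namespace MultiGraph

section Cells

variable {V E : Type*} (G : MultiGraph V E)

/-- The cell `ac|b`: `a ~ c ∧ a ≁ b`. -/
abbrev CellAC (ω : Config E) (a b c : V) : Prop := G.Conn ω a c ∧ ¬ G.Conn ω a b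

/-- The cell `bc|a`: `b ~ c ∧ a ≁ b`. -/
abbrev CellBC (ω : Config E) (a b c : V) : Prop := G.Conn ω b c ∧ ¬ G.Conn ω a b

/-- The two cells are disjoint. -/
theorem not_cellAC_and_cellBC {ω : Config E} {a b c : V} (h : G.CellAC ω a b c) :
    ¬ G.CellBC ω a b c :=
  fun h' => h.2 (h.1.trans h'.1.symm)

/-- An edge between `K = Com_a(S)` and `M = Com_c(S)`. -/
def IsKM (ω : Config E) (a c : V) (e : E) : Prop :=
  (G.fst e ∈ G.cluster ω a ∧ G.snd e ∈ G.cluster ω c) ∨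
    (G.fst e ∈ G.cluster ω c ∧ G.snd e ∈ G.cluster ω a)

/-- **P7 lands**: for `S ∈ bot`, opening a `K–M` edge joins `a` to `c` and leaves `b`'s cluster `L`
untouched — the target is in `ac|b`. -/
theorem cellAC_update_of_isBot_of_isKM [DecidableEq E] {ω : Config E} {a b c : V}
    (h : G.IsBot ω a b c) {e : E} (he : G.IsKM ω a c e) :
    G.CellAC (Function.update ω e true) a b c := by
  have hle : ω ≤ Function.update ω e true := le_update_true ω e
  have hopen : G.OpenAdj (Function.update ω e true) (G.fst e) (G.snd e) :=
    G.openAdj_of_open e (Function.update_self e true ω)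
  constructor
  · rcases he with ⟨hf, hs⟩ | ⟨hf, hs⟩
    · exact ((hf : G.Conn ω a (G.fst e)).mono hle).trans
        ((Conn.of_openAdj hopen).trans ((hs : G.Conn ω c (G.snd e)).mono hle).symm)
    · exact ((hs : G.Conn ω a (G.snd e)).mono hle).trans
        ((Conn.of_openAdj hopen.symm).trans ((hf : G.Conn ω c (G.fst e)).mono hle).symm)
  · intro hab
    -- `e` is not at `L`: its endpoints are in `K` and `M`, both disjoint from `L`
    have hnotL : e ∉ G.edgesAt (G.cluster ω b) := by
      intro hL
      rcases he with ⟨hf, hs⟩ | ⟨hf, hs⟩ <;> rcases hL with hL | hL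
      · exact h.1 (G.mem_cluster_of_mem_inter hf hL)
      · exact h.2.2 ((G.mem_cluster_of_mem_inter hL hs) : G.Conn ω b c)
      · exact h.2.2 ((G.mem_cluster_of_mem_inter hL hf) : G.Conn ω b c)
      · exact h.1 (G.mem_cluster_of_mem_inter hs hL)
    have hL : G.cluster (Function.update ω e true) b = G.cluster ω b := by
      refine cluster_eq_of_agree fun e' he' => ?_
      have hne : e' ≠ e := fun h' => hnotL (h' ▸ he')
      rw [Function.update_of_ne hne]
    have : a ∈ G.cluster (Function.update ω e true) b := hab.symm
    rw [hL] at this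
    exact h.1 (this : G.Conn ω b a).symm

end Cells

section Passes

variable {V E : Type*} (G : MultiGraph V E)

open Classical in
/-- A sealing-tree pass: the image of the tree when it lies in the designated cell, nothing otherwise. -/
noncomputable def treePass (f : Config E → Config E) (cell : Config E → Prop) (S : Config E) :
    List (Config E) :=
  if cell (f S) then [f S] else []

omit G in
/-- Membership in a tree pass. -/
theorem mem_treePass {f : Config E → Config E} {cell : Config E → Prop} {S T : Config E} :
    T ∈ treePass f cell S ↔ T = f S ∧ cell T := by
  unfold treePass
  split_ifs with h
  · constructor
    · intro hT
      rw [List.mem_singleton] at hT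
      exact ⟨hT, hT ▸ h⟩
    · intro hT
      rw [List.mem_singleton]
      exact hT.1
  · constructor
    · intro hT
      simp at hT
    · rintro ⟨rfl, hT⟩
      exact absurd hT h

variable [Fintype E] [DecidableEq E]

open Classical in
/-- **P7**: `S ∪ {e}` for the `K–M` edges `e` in the edge order, kept when in `ac|b`. -/
noncomputable def kmPass (a b c : V) (S : Config E) : List (Config E) :=
  (((Finset.univ : Finset E).toList.filter fun e => decide (G.IsKM S a c e)).map
    fun e => Function.update S e true).filter fun T => decide (G.CellAC T a b c)

open Classical in
/-- **P8**: `S ∪ X` for `|X| ≤ 2` in the edge order, kept when in `ac|b` or `bc|a`. -/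
noncomputable def twoEdgePass (a b c : V) (S : Config E) : List (Config E) :=
  (((Finset.univ : Finset E).toList.map fun e => Function.update S e true) ++
      (Finset.univ : Finset E).toList.flatMap fun e =>
        (Finset.univ : Finset E).toList.map fun e' =>
          Function.update (Function.update S e true) e' true).filter
    fun T => decide (G.CellAC T a b c ∨ G.CellBC T a b c)

/-- Every P7 target is in `ac|b`. -/
theorem cellAC_of_mem_kmPass {a b c : V} {S T : Config E} (h : T ∈ G.kmPass a b c S) :
    G.CellAC T a b c := by
  unfold kmPass at h
  rw [List.mem_filter] at h
  simpa using h.2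

/-- Every P8 target is in `ac|b` or `bc|a`. -/
theorem cell_of_mem_twoEdgePass {a b c : V} {S T : Config E} (h : T ∈ G.twoEdgePass a b c S) :
    G.CellAC T a b c ∨ G.CellBC T a b c := by
  unfold twoEdgePass at h
  rw [List.mem_filter] at h
  simpa using h.2

/-- The pairs `(e, e')` with `e` before `e'` in the list, in lexicographic order of positions. -/
def pairsOf {β : Type*} : List β → List (β × β)
  | [] => []
  | e :: es => (es.map fun e' => (e, e')) ++ pairsOf es

/-- Every listed pair comes from the list. -/
theorem mem_pairsOf {β : Type*} {es : List β} {q : β × β} (h : q ∈ pairsOf es) :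
    q.1 ∈ es ∧ q.2 ∈ es := by
  induction es with
  | nil => simp [pairsOf] at h
  | cons e es ih =>
    simp only [pairsOf, List.mem_append, List.mem_map] at h
    rcases h with ⟨e', he', rfl⟩ | h
    · exact ⟨List.mem_cons_self .., List.mem_cons_of_mem _ he'⟩
    · obtain ⟨h1, h2⟩ := ih h
      exact ⟨List.mem_cons_of_mem _ h1, List.mem_cons_of_mem _ h2⟩

open Classical in
/-- **A one-edge pass with a caller-supplied candidate order**: `S ∪ {e}` for the edges `e` of
`cand S` in order, kept when in `ac|b` or `bc|a`. -/
noncomputable def oneEdgePassOrd (cand : Config E → List E) (a b c : V) (S : Config E) :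
    List (Config E) :=
  ((cand S).map fun e => Function.update S e true).filter
    fun T => decide (G.CellAC T a b c ∨ G.CellBC T a b c)

open Classical in
/-- **A two-edge pass with a caller-supplied candidate order**: `S ∪ {e, e'}` for the pairs of
`cand S` in order, kept when in `ac|b` or `bc|a`. -/
noncomputable def twoEdgePassOrd (cand : Config E → List (E × E)) (a b c : V) (S : Config E) :
    List (Config E) :=
  ((cand S).map fun q => Function.update (Function.update S q.1 true) q.2 true).filter
    fun T => decide (G.CellAC T a b c ∨ G.CellBC T a b c)

omit [Fintype E] in
/-- Every target of an ordered one-edge pass is in `ac|b` or `bc|a`. -/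
theorem cell_of_mem_oneEdgePassOrd {cand : Config E → List E} {a b c : V} {S T : Config E}
    (h : T ∈ G.oneEdgePassOrd cand a b c S) : G.CellAC T a b c ∨ G.CellBC T a b c := by
  unfold oneEdgePassOrd at h
  rw [List.mem_filter] at h
  simpa using h.2

omit [Fintype E] in
/-- Every target of an ordered two-edge pass is in `ac|b` or `bc|a`. -/
theorem cell_of_mem_twoEdgePassOrd {cand : Config E → List (E × E)} {a b c : V} {S T : Config E}
    (h : T ∈ G.twoEdgePassOrd cand a b c S) : G.CellAC T a b c ∨ G.CellBC T a b c := by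
  unfold twoEdgePassOrd at h
  rw [List.mem_filter] at h
  simpa using h.2

/-- **Completeness of a pass scheme on a source set `R`**: some enumeration of `R` is fully served
by the run of the passes. -/
def SchemeComplete (R : Config E → Prop) (passes : List (Config E → List (Config E))) : Prop :=
  ∃ xs : List (Config E), (∀ x, x ∈ xs ↔ R x) ∧
    ∀ x ∈ xs, x ∈ (PassScheme.run (PassScheme.requests xs passes)).map Prod.fst

open Classical in
/-- **A complete scheme with all candidates in `ac|b ⊔ bc|a` bounds its source set**: the run is an
injection `R ↪ ac|b ⊔ bc|a` by construction (`PassScheme.inv_run`). -/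
theorem card_le_of_schemeComplete {a b c : V} (R : Config E → Prop)
    (passes : List (Config E → List (Config E)))
    (hcell : ∀ cand ∈ passes, ∀ S T : Config E, T ∈ cand S → G.CellAC T a b c ∨ G.CellBC T a b c)
    (h : SchemeComplete R passes) :
    (Finset.univ.filter fun ω : Config E => R ω).card ≤
      (Finset.univ.filter fun ω : Config E => G.Conn ω a c ∧ ¬ G.Conn ω a b).card +
        (Finset.univ.filter fun ω : Config E => G.Conn ω b c ∧ ¬ G.Conn ω a b).card := by
  obtain ⟨xs, hxs, hcomp⟩ := h
  have h1 : (Finset.univ.filter fun ω : Config E => R ω) = xs.toFinset := by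
    ext ω
    simp only [Finset.mem_filter, Finset.mem_univ, true_and, List.mem_toFinset]
    exact (hxs ω).symm
  have h2 : (Finset.univ.filter fun ω : Config E => G.CellAC ω a b c ∨ G.CellBC ω a b c).card =
      (Finset.univ.filter fun ω : Config E => G.Conn ω a c ∧ ¬ G.Conn ω a b).card +
        (Finset.univ.filter fun ω : Config E => G.Conn ω b c ∧ ¬ G.Conn ω a b).card := by
    rw [← Finset.card_union_of_disjoint]
    · congr 1
      ext ω
      simp only [Finset.mem_filter, Finset.mem_univ, true_and, Finset.mem_union, CellAC, CellBC]
    · rw [Finset.disjoint_left]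
      intro ω h1 h2
      simp only [Finset.mem_filter, Finset.mem_univ, true_and] at h1 h2
      exact G.not_cellAC_and_cellBC h1 h2
  rw [h1, ← h2]
  refine PassScheme.card_le_of_complete xs _ _ ?_ hcomp
  intro r hr t ht
  rw [PassScheme.mem_requests] at hr
  obtain ⟨cand, hc, x, _, rfl⟩ := hr
  simp only [Finset.mem_filter, Finset.mem_univ, true_and]
  exact hcell cand hc x t ht

/-- **The reduced pass scheme of C-026**: P2 `τ₅₀` → `ac|b`, P3 `τ₄` → `bc|a`, P4 `τ₄₀` → `ac|b`,
P5 `τ₁₈` → `bc|a`, P7 (`K–M` edge) → `ac|b`, P8 (`≤ 2` edges) → `ac|b ⊔ bc|a`. -/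
noncomputable def q3Passes (a b c : V) : List (Config E → List (Config E)) :=
  [treePass (G.kSwapSealed c b) (fun T => G.CellAC T a b c),
    treePass (G.kSwapSealed b a) (fun T => G.CellBC T a b c),
    treePass (G.kSwapSealed a b) (fun T => G.CellAC T a b c),
    treePass (G.kSwapSealed c a) (fun T => G.CellBC T a b c),
    G.kmPass a b c,
    G.twoEdgePass a b c]

/-- Every candidate of every pass lies in `ac|b ⊔ bc|a`. -/
theorem cell_of_mem_q3Passes {a b c : V} :
    ∀ cand ∈ G.q3Passes a b c, ∀ S T : Config E, T ∈ cand S →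
      G.CellAC T a b c ∨ G.CellBC T a b c := by
  intro cand hc S T hT
  simp only [q3Passes, List.mem_cons, List.not_mem_nil, or_false] at hc
  rcases hc with rfl | rfl | rfl | rfl | rfl | rfl
  · exact Or.inl (mem_treePass.mp hT).2
  · exact Or.inr (mem_treePass.mp hT).2
  · exact Or.inl (mem_treePass.mp hT).2
  · exact Or.inr (mem_treePass.mp hT).2
  · exact Or.inl (G.cellAC_of_mem_kmPass hT)
  · exact G.cell_of_mem_twoEdgePass hT

/-- **Completeness of the scheme** (mine-3's claim C6): in some order of the residual `Bot₃`, the run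
of the passes serves every residual configuration. -/
def Q3Complete (a b c : V) : Prop := SchemeComplete (fun ω => G.Bot3 ω a b c) (G.q3Passes a b c)

open Classical in
/-- **A complete scheme gives the class lemma**: the run is an injection `Bot₃ ↪ ac|b ⊔ bc|a` by
construction, hence `#Bot₃ ≤ #(ac|b) + #(bc|a)`. -/
theorem card_bot3_le_of_q3Complete {a b c : V} (h : G.Q3Complete a b c) :
    (Finset.univ.filter fun ω : Config E => G.Bot3 ω a b c).card ≤
      (Finset.univ.filter fun ω : Config E => G.Conn ω a c ∧ ¬ G.Conn ω a b).card +
        (Finset.univ.filter fun ω : Config E => G.Conn ω b c ∧ ¬ G.Conn ω a b).card :=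
  G.card_le_of_schemeComplete _ _ G.cell_of_mem_q3Passes h

end Passes

end MultiGraph

/-- **Completeness of the C-026 scheme on the simple graphs with ≤ N vertices and three distinct
marks.** -/
def Q3CompleteSimpleUpTo (N : ℕ) : Prop :=
  ∀ {V E : Type} [Fintype V] [Fintype E] [DecidableEq E], Fintype.card V ≤ N →
    ∀ (G : MultiGraph V E), G.IsSimple → ∀ a b c : V, a ≠ b → a ≠ c → b ≠ c →
      G.Q3Complete a b c

/-- A complete scheme on the simple graphs with ≤ N vertices gives the residual bound there. -/
theorem Bot3BoundSimpleUpTo_of_q3Complete {N : ℕ} (h : Q3CompleteSimpleUpTo N) :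
    Bot3BoundSimpleUpTo N :=
  fun hV G hs a b c hab hac hbc => G.card_bot3_le_of_q3Complete (h hV G hs a b c hab hac hbc)

/-- **C-026 on every multigraph with ≤ N vertices, at every `p`, from the completeness of mine-3's
pass scheme on the simple graphs with ≤ N vertices** — the pass argument: injectivity is by
construction, completeness (claim C6) is the only open piece. -/
theorem C026UpTo_of_q3Complete {N : ℕ} (h : Q3CompleteSimpleUpTo N) : C026UpTo N :=
  C026UpTo_of_bot3Bound (Bot3BoundSimpleUpTo_of_q3Complete h)

end PercRepro
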